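import Summits.CriticalPhenomena.PercolationContinuityZ3.Theorems.Transplant.PlanarSkeletonFrmQuasiDefs
import Summits.CriticalPhenomena.PercolationContinuityZ3.Theorems.Transplant.SkelFrmQuasi1ChoiceDefs
import Summits.CriticalPhenomena.PercolationContinuityZ3.Theorems.Transplant.SkelFrm1ChoiceDefs
import Summits.CriticalPhenomena.PercolationContinuityZ3.Theorems.Transplant.SkelFrmFrom1ClosureL
import Summits.CriticalPhenomena.PercolationContinuityZ3.Theorems.Transplant.SkelFrm1ClosureL
import HarnessLib
import Summits.CriticalPhenomena.PercolationContinuityZ3.Theorems.Transplant.SkelFrm1ChoiceL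
/-!
# GEN-Q PORT (WAVE-Q table v0.8 section 2, row G018, U-level L4; captain R-6/R-7 2026-08-27: carrier token swap `PlanarSkeletonFrmFrom ↦ PlanarSkeletonFrmQuasi`)
# of the tree module «Transplant/SkelFrmFrom1ChoiceL» (sha256 480e3fefe1317697…) onto the quasi-step carrier `PlanarSkeletonFrmQuasi` (p507026): «SkelFrmQuasi1ChoiceL»

ORIGINAL TITLE: N2 (the frames-only node `SamePDropOfSkeletonFrm₁`, OPEN), WAVE 0 (c2) file 4b: THE FACE AND CORRIDOR OBLIGATIONS OF A CHOICE AND THE CLOSURE OF RECORD FROM A CHOICE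

builds on p205010 (kernel theorem, internal audit signed; external expert review pending) — nothing in this file uses p205010; NOTHING is claimed about any open node
((N3-b), the end state).  Lane `prim-bschramm`, seat `prim-bschramm-gen-1` (gen 4; binder-wave captain).  Helper file (`--supports stmt-CriticalPhenomena-4575 --as helper`).
PORT RULES (U-wave r1–r4 re-used, GEN-Q hunk classes of p3-g29 #6136): declaration order, names and proof texts are those of «SkelFrmFrom1ChoiceL», byte-identical except
(i) the carrier token `PlanarSkeletonFrmFrom ↦ PlanarSkeletonFrmQuasi` in binders, `namespace`/`end` lines and qualified names (module names `SkelFrmFrom… ↦ SkelFrmQuasi…`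
in imports of already-ported rows); (ii) `Φ.step ↦ Φ.qstep` with the called Steps lemma replaced by its `…Q`/`_q` twin and the cost `Φ.M` threaded (none in this file unless
listed below); (iii) `Φ.cyl_connected ↦ Φ.cyl_reach` readers (none unless listed); (iv) graph-ball radii / window floors ×`Φ.M` (none unless listed).  Carrier-free
residents stay imported/exported from the original «SkelFrm1ChoiceL» exactly as in the FrmFrom port.  Docstrings and citations are the original's.

-/

noncomputable section

open MeasureTheory ProbabilityTheory
open scoped ENNReal Classical

namespace Summit.CriticalPhenomena.PercolationContinuityZ3.Theorems.Transplant

open Literature.Probability.Percolation Literature.Probability.LatticeModels SimpleGraph KNCells KNLevels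
open Literature.Barriers.CriticalPhenomena (HasExponentialGrowth)
open GadgetSystem (tgt)
open SkelConc (Consts)

namespace PlanarSkeletonFrmQuasi

variable {V : Type} [DecidableEq V] [Countable V] {G : SimpleGraph V} [G.LocallyFinite]

namespace ChoiceNQ

variable {κ : Consts} {Φ : PlanarSkeletonFrmQuasi G} {t : V} {p : unitInterval} {hC : Φ.CylSubcritical p}

/-- **The face residue, oriented, window map per face, (S0) kits** ((F) column). [this work] -/
def FaceHoldsRNQ (𝒞 : ChoiceNQ κ Φ t p hC) : Prop :=
  ∀ (O : Skelφ.StepI.OutNS V) (q : unitInterval), 𝒞.AtQNQ O q → Skelφ.FaceOblRMOF G (𝒞.scheme O q) (𝒞.FD O q) Φ.Δ κ.δ₂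

/-- **The corridor residue, oriented, LENGTH-BUDGETED at the flat root accuracy** ((C) column, K-G corridor): for SOME `nmax ≤ Lf κ.K₀`. [this work] -/
def ReachHoldsRHNQL (Lf : ℕ → ℕ) (𝒞 : ChoiceNQ κ Φ t p hC) : Prop :=
  ∀ (O : Skelφ.StepI.OutNS V) (q : unitInterval), 𝒞.AtQNQ O q →
    ∃ nmax : ℕ, nmax ≤ Lf κ.K₀ ∧ Skel.ReachOblRHNOF G nmax (𝒞.scheme O q) (𝒞.FD O q) Φ.Δ (κ.δr 0)

end ChoiceNQ

-- GEN-Q (R-2, captain 2026-08-27): `PlanarSkeletonFrmFrom.FaceHoldsRNQFnL` is not in the used cone of the node top — not ported.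

-- GEN-Q (R-2, captain 2026-08-27): `PlanarSkeletonFrmFrom.ReachHoldsRHNQFnL` is not in the used cone of the node top — not ported.

-- GEN-Q (R-2, captain 2026-08-27): `PlanarSkeletonFrmFrom.samePDropOfSkeletonFrmFrom₁_of_choiceFnNQL` is not in the used cone of the node top — not ported.

end PlanarSkeletonFrmQuasi

end Summit.CriticalPhenomena.PercolationContinuityZ3.Theorems.Transplant

end
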